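import Literature.AnabelianGeometry.EtaleTheta.Discharge.Sec3Thm37iUnitProfiniteAtTateTowerArithPadic
import Literature.AnabelianGeometry.EtaleTheta.Discharge.Sec3Thm37iNodeGenuineBase
import Literature.AnabelianGeometry.EtaleTheta.Discharge.Sec3Thm37ivNode
import HarnessLib

/-!
# [EtTh] Theorem 3.7 (i) with NO binder for EVERY tempered Frobenioid over the `ℚ_p` arithmetic Tate tower data and print's
# genuine base `B^temp(Π)⁰`: the Prop. 3.4 (ii) binder `hP34` holds at EVERY connected covering of the `ℚ_p`-tower

S. Mochizuki, *The étale theta function and its Frobenioid-theoretic manifestations*, Publ. RIMS **45** (2009) [EtTh], §3: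
Prop. 3.4 (ii), PRIMS PDF p.74 ("`O_L^× ⥲ Ker(B₀(Y^log) → Φ₀^gp(Y^log))`" for every connected tempered covering `Y^log`);
Theorem 3.7 (i), statement PDF p.79 (printed p.305) ll.30–31, proof PDF p.80 ll.8–15; Theorem 3.7 (iv), p.80 l.7
[cite: MochizukiEtTh2009, Thm 3.7 (i) p.79].

PROOF-ONLY companion (theorems only: no `def`, no `Prop` fact, no instance, no notation; abc-iut cell, layer L2, cone node
**`EtTh:Thm3.7(i)`**; in-lineage sequel to `Sec3Thm37iUnitProfiniteAtTateTowerArithPadic` (p496800), seat abc-iut-w6-d061 gen 7,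
self-named row «HP34-PADIC@ALL-COVERINGS+GENUINE-BASE»).  Nothing landed is edited or restated; everything is consumed BY NAME.

p496800 discharged the `hP34` binder of abc-iut-w4-d103's node closer `TemperedFrobenioid.thm37_i_node` at the ONE-POINT base
`pt ↦ G/G` of the `ℚ_p`-tower (`TateTowerArithFrd.temperedFrobenioid (Datum.padic p) R S`).  THIS FILE lifts it to EVERY
connected covering and hence to EVERY tempered Frobenioid over these data:
* §1 `TateTowerArithFrd.divΛ_eq_one_iff` (any datum, any connected covering `Y`: `divΛ b = 1 ↔ div₀ b = 1`),
  `exists_eq_of_mem_ker_padic` (a kernel unit of `B₀(S)` takes at every point a value `c·U⁰`, `v c = 1`),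
  `constFamilyOn_mem_bZero_padic` / `divZeroHom_constFamilyOn_padic` (the constant family `c·U⁰` on any `S`);
* §2 **`TateTowerArithFrd.nonempty_ker_mulEquiv_padicUnits_obj (Y)`** — for EVERY connected covering `Y = S` of the
  `ℚ_p`-tower (nonempty transitive `ℤ × Aut(ℚ_p/ℚ_p)`-set, no quotient presentation needed):
  `Ker(B₀(S)ˣ → (Φ₀^rlf)^gp(S)) ≃* ℤ_p^× = PadicFrd.unitSubgroup ℚ_[p]` (evaluation at a point; transitivity ⇒ injective;
  constant families ⇒ surjective); hence **`TemperedFrobenioid.hP34_padicTower (C₀) (A)`** — the LITERAL `hP34` binder for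
  EVERY tempered Frobenioid `C₀` over the `ℚ_p`-tower data, ANY base category `D`, ANY base functor, ANY category vocabulary
  (`L := PadicFrd.qpFld p`);
* §3 `TemperedFrobenioid.thm37_i_node_padicTower (C₀) (hBmon)` — over `treeCatVocab D R′ S′`, all seven printed clauses of
  Thm. 3.7 (i) ⟸ {`hBmon`} ALONE (`hP34` := §2, `hinj` vacuous at `Λ = ℤ`);
* §4 **at print's GENUINE base `B^temp(Π)⁰`** (every topological group `Π`; `hBD` ⟸ abc-iut-w6-d058's `hBinj_tateTowerArith`,
  the FSM clause ⟸ [FrdII] Ex. 1.3 (i) inside abc-iut-w5-d179's `thm37_i_node_connectedPart_of_baseInj`):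
  **`TemperedFrobenioid.thm37_i_padicTower_connectedPart (C₀)` — [EtTh] Thm. 3.7 (i), ALL SEVEN clauses, NO binder, for EVERY
  tempered Frobenioid over (`ℚ_p`-tower data, `B^temp(Π)⁰`, `treeCatVocab`)**; `isOfUnitProfiniteType_padicTower_connectedPart`;
  **`thm37_iv_padicTower_connectedPart (C₀) : C₀.Thm37_iv ∧ (IsSlim B^temp(Π)⁰ → IsSlim C₀)`** NO binder (abc-iut-w4-d103's
  `thm37_iv_node_connectedPart_of_baseInj`);
  non-vacuity of the quantifier: `TateTowerArithFrd.nonempty_temperedFrobenioid_connectedPart` (in tree).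
HONEST FRAMING: refereed pre-IUT material ([EtTh] §3 over [FrdI] §§1–5, [FrdII] Thm. 1.2 (i)); the `ℚ_p`-tower is a class-(b)
arithmetic consistency witness (`K = L = ℚ_p`, `Aut(L/K) = 1`; not the formal-scheme Tate tower); bookkeeping over PROVED rows, no
new mathematics; nothing here bears on [IUTchIII] Cor. 3.12; no side taken; typed ≠ proved — here PROVED with no binder.
-/

noncomputable section

namespace Literature.AnabelianGeometry.EtaleTheta

open CategoryTheory Opposite Function Literature.AlgebraicGeometry.Frobenioids Literature.AnabelianGeometry.SemiGraphs
  IsDedekindDomain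

universe u v

/-! ### §1 Kernel elements and constant families on an arbitrary connected covering of the `ℚ_p`-tower -/

namespace TateTowerArithFrd

open LogDivisorModel LogDivisorModel.GaloisAction LogDivisorModel.TateTowerArith PadicDivisible

variable (p : ℕ) [hp : Fact p.Prime]

/-- At any connected covering `Y` of the arithmetic Tate tower (any datum `D`): `b ∈ B₀^ℤ(Y) = B₀(Y)` has trivial `Λ`-divisor in
`(Φ₀^rlf)^gp(Y)` iff `div₀ b = 1` in `Φ₀^gp(Y)` (abc-iut-w6-d058's `ker_divΛ_rlfZ_ofGaloisActionConnected` with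
`GaloisAction.divZeroHom_eq_one_iff`). [cite: MochizukiEtTh2009, Prop 3.4 p.74] -/
theorem divΛ_eq_one_iff {K L : Type} [Field K] [Field L] [Algebra K L] (D : Datum K L) (Y : (D₀ K L)ᵒᵖ)
    (b : (RealifiedDivisorMonoids.ofRlfZWeak (dm D) (hpf D)).BΛ.obj Y) :
    (RealifiedDivisorMonoids.ofRlfZWeak (dm D) (hpf D)).divΛ Y b = 1 ↔ D.action.divZeroHom Y.unop.obj b = 1 := by
  constructor
  · intro hb
    exact (D.action.divZeroHom_eq_one_iff Y.unop.obj b).2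
      (DivisorMonoids.ker_divΛ_rlfZ_ofGaloisActionConnected D.action D.cuspLaws (fun _ => True) (fun _ => True) Y b hb)
  · intro hb
    rw [RealifiedDivisorMonoids.ofRlfZWeak_divΛ_apply]
    change EtaleTheta.gpMap _ (D.action.divZeroHom Y.unop.obj b) = 1
    rw [hb]
    exact map_one _

/-- At the `ℚ_p`-tower, EVERY connected covering `Y = S`: a unit `u` of `B₀(S)` in the kernel of `B₀(S)ˣ → (Φ₀^rlf)^gp(S)` takes at
every point `s` the value `c·U⁰` for some `c ∈ ℚ_p^×` with `v c = 1` (Prop. 3.2 (ii) via `GaloisAction.divZeroHom_eq_one_iff`, then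
abc-iut-w6-d058's `ConstField.valuation_eq_one_of_mem_intConst` at `Datum.constField`). [cite: MochizukiEtTh2009, Prop 3.4 p.74] -/
theorem exists_eq_of_mem_ker_padic (Y : (D₀ ℚ_[p] ℚ_[p])ᵒᵖ)
    (u : ((RealifiedDivisorMonoids.ofRlfZWeak (dm (Datum.padic p)) (hpf (Datum.padic p))).BΛ.obj Y)ˣ)
    (hu : u ∈ (((RealifiedDivisorMonoids.ofRlfZWeak (dm (Datum.padic p)) (hpf (Datum.padic p))).divΛ Y).comp
      (Units.coeHom _)).ker) (s : Y.unop.obj.V) :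
    ∃ c : ℚ_[p]ˣ, (primeSpec p).valuation ℚ_[p] (c : ℚ_[p]) = 1 ∧
      (u : (RealifiedDivisorMonoids.ofRlfZWeak (dm (Datum.padic p)) (hpf (Datum.padic p))).BΛ.obj Y).1 s =
        ((c, 1) : (Datum.padic p).model.Fn) := by
  rw [MonoidHom.mem_ker, MonoidHom.comp_apply, Units.coeHom_apply, divΛ_eq_one_iff] at hu
  obtain ⟨hint, hinv⟩ := ((Datum.padic p).action.divZeroHom_eq_one_iff Y.unop.obj _).1 hu s
  have hk : ((u : (RealifiedDivisorMonoids.ofRlfZWeak (dm (Datum.padic p)) (hpf (Datum.padic p))).BΛ.obj Y).1 s).2 = 1 :=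
    hint.2
  have hf : (u : (RealifiedDivisorMonoids.ofRlfZWeak (dm (Datum.padic p)) (hpf (Datum.padic p))).BΛ.obj Y).1 s =
      (Datum.padic p).constField.emb
        ((u : (RealifiedDivisorMonoids.ofRlfZWeak (dm (Datum.padic p)) (hpf (Datum.padic p))).BΛ.obj Y).1 s).1 :=
    Prod.ext rfl hk
  rw [hf] at hint hinv
  exact ⟨_, (Datum.padic p).constField.valuation_eq_one_of_mem_intConst _ hint hinv, hf⟩

/-- At the `ℚ_p`-tower the constant family `c·U⁰` (`c ∈ ℚ_p^×`) on ANY covering `S` lies in `B₀(S)` (`ℤ × Aut(ℚ_p/ℚ_p)`-invariant).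
[cite: MochizukiEtTh2009, Def 3.3 p.73] -/
theorem constFamilyOn_mem_bZero_padic (S : Action (Type 0) (Grp ℚ_[p] ℚ_[p])) (c : ℚ_[p]ˣ) :
    (fun _ : S.V => ((c, 1) : (Datum.padic p).model.Fn)) ∈ (Datum.padic p).action.bZero S := by
  refine ⟨fun _ => trivial, fun g _ => ?_⟩
  change ((c, 1) : ℚ_[p]ˣ × Multiplicative ℤ) = (Datum.padic p).act g (c, 1)
  refine Prod.ext ?_ rfl
  rw [Datum.act_fst, toAdd_one, zero_mul, neg_zero, zpow_zero, mul_one]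
  refine Units.ext ?_
  rw [Units.coe_map, MonoidHom.coe_coe]
  have h := (g.2).commutes (c : ℚ_[p])
  rw [Algebra.algebraMap_self_apply] at h
  exact h.symm

/-- … and, when `v c = 1`, has trivial log-divisor on `S`: `div₀(c·U⁰) = 1` (unit integral constant values,
`ConstField.emb_mem_intConst_and_inv_mem`). [cite: MochizukiEtTh2009, Prop 3.4 p.74] -/
theorem divZeroHom_constFamilyOn_padic (S : Action (Type 0) (Grp ℚ_[p] ℚ_[p])) (c : ℚ_[p]ˣ)
    (hc : (primeSpec p).valuation ℚ_[p] (c : ℚ_[p]) = 1) :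
    (Datum.padic p).action.divZeroHom S ⟨_, constFamilyOn_mem_bZero_padic p S c⟩ = 1 :=
  ((Datum.padic p).action.divZeroHom_eq_one_iff S _).2 fun _ => (Datum.padic p).constField.emb_mem_intConst_and_inv_mem c hc

/-! ### §2 Prop. 3.4 (ii) isomorphism 1 at EVERY connected covering; `hP34` for EVERY tempered Frobenioid over the `ℚ_p`-tower -/

/-- **`Ker(B₀(S)ˣ → (Φ₀^rlf)^gp(S)) ≃* ℤ_p^× = PadicFrd.unitSubgroup ℚ_[p]` for EVERY connected covering `Y = S` of the arithmetic
Tate tower over `ℚ_p`** (Prop. 3.4 (ii), isomorphism 1, with a GENUINE p-adic `O_L^×`, at every `Y^log`): `u ↦ c`, the value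
`c·U⁰` of `u` at a (chosen) point of the nonempty transitive `G`-set `S`; injective by transitivity and `G`-equivariance,
surjective by the constant families. [cite: MochizukiEtTh2009, Prop 3.4 p.74] -/
theorem nonempty_ker_mulEquiv_padicUnits_obj (Y : (D₀ ℚ_[p] ℚ_[p])ᵒᵖ) :
    Nonempty ((((RealifiedDivisorMonoids.ofRlfZWeak (dm (Datum.padic p)) (hpf (Datum.padic p))).divΛ Y).comp
      (Units.coeHom ((RealifiedDivisorMonoids.ofRlfZWeak (dm (Datum.padic p)) (hpf (Datum.padic p))).BΛ.obj Y))).ker ≃*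
        PadicFrd.unitSubgroup ℚ_[p]) := by
  obtain ⟨hne, htrans⟩ := Y.unop.property
  let s₀ : Y.unop.obj.V := hne.some
  -- the evaluation homomorphism `u ↦ (u(s₀)).1 : B₀(S)ˣ →* ℚ_p^×`
  let ev : ((RealifiedDivisorMonoids.ofRlfZWeak (dm (Datum.padic p)) (hpf (Datum.padic p))).BΛ.obj Y)ˣ →* ℚ_[p]ˣ :=
    { toFun := fun u => ((u : (RealifiedDivisorMonoids.ofRlfZWeak (dm (Datum.padic p)) (hpf (Datum.padic p))).BΛ.obj Y).1 s₀).1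
      map_one' := rfl
      map_mul' := fun _ _ => rfl }
  have hev : ∀ u ∈ (((RealifiedDivisorMonoids.ofRlfZWeak (dm (Datum.padic p)) (hpf (Datum.padic p))).divΛ Y).comp
      (Units.coeHom _)).ker, ev u ∈ PadicFrd.unitSubgroup ℚ_[p] := fun u hu => by
    obtain ⟨c, hv, hc⟩ := exists_eq_of_mem_ker_padic p Y u hu s₀
    have hcu : ev u = c := congrArg Prod.fst hc
    rw [hcu]
    exact (valuation_primeSpec_eq_one_iff_mem_unitSubgroup p c).1 hv
  let f := (ev.comp (Subgroup.subtype _)).codRestrict (PadicFrd.unitSubgroup ℚ_[p]) fun u => hev u.1 u.2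
  refine ⟨MulEquiv.ofBijective f ⟨?_, ?_⟩⟩
  · -- injective: a kernel element is determined by its value at `s₀` (transitivity + equivariance)
    intro u u' h
    obtain ⟨c, -, hc⟩ := exists_eq_of_mem_ker_padic p Y u.1 u.2 s₀
    obtain ⟨c', -, hc'⟩ := exists_eq_of_mem_ker_padic p Y u'.1 u'.2 s₀
    have hcc : c = c' := by
      have h1 : ((f u : PadicFrd.unitSubgroup ℚ_[p]) : ℚ_[p]ˣ) = c := congrArg Prod.fst hc
      have h2 : ((f u' : PadicFrd.unitSubgroup ℚ_[p]) : ℚ_[p]ˣ) = c' := congrArg Prod.fst hc'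
      rw [← h1, ← h2, h]
    have h0 : (u.1 : (RealifiedDivisorMonoids.ofRlfZWeak (dm (Datum.padic p)) (hpf (Datum.padic p))).BΛ.obj Y).1 s₀ =
        (u'.1 : (RealifiedDivisorMonoids.ofRlfZWeak (dm (Datum.padic p)) (hpf (Datum.padic p))).BΛ.obj Y).1 s₀ := by
      rw [hc, hc', hcc]
    refine Subtype.ext (Units.ext (Subtype.ext (funext fun s => ?_)))
    obtain ⟨g, rfl⟩ := htrans s₀ s
    have e : ∀ w : (RealifiedDivisorMonoids.ofRlfZWeak (dm (Datum.padic p)) (hpf (Datum.padic p))).BΛ.obj Y,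
        w.1 (Y.unop.obj.ρ g s₀) = (Datum.padic p).action.actFn g (w.1 s₀) := fun w => w.2.2 g s₀
    rw [e, e, h0]
  · -- surjective: `c ↦ c·U⁰`
    rintro ⟨c, hcU⟩
    have hv : (primeSpec p).valuation ℚ_[p] (c : ℚ_[p]) = 1 := (valuation_primeSpec_eq_one_iff_mem_unitSubgroup p c).2 hcU
    let b : (RealifiedDivisorMonoids.ofRlfZWeak (dm (Datum.padic p)) (hpf (Datum.padic p))).BΛ.obj Y :=
      ⟨_, constFamilyOn_mem_bZero_padic p Y.unop.obj c⟩
    have hb : (RealifiedDivisorMonoids.ofRlfZWeak (dm (Datum.padic p)) (hpf (Datum.padic p))).divΛ Y b = 1 :=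
      (divΛ_eq_one_iff (Datum.padic p) Y b).2 (divZeroHom_constFamilyOn_padic p Y.unop.obj c hv)
    have hunit := (RealifiedDivisorMonoids.ofRlfZWeak (dm (Datum.padic p)) (hpf (Datum.padic p))).isUnit_BΛ _ b
    refine ⟨⟨hunit.unit, ?_⟩, Subtype.ext ?_⟩
    · rw [MonoidHom.mem_ker, MonoidHom.comp_apply, Units.coeHom_apply, IsUnit.unit_spec]
      exact hb
    · change ((hunit.unit : (RealifiedDivisorMonoids.ofRlfZWeak (dm (Datum.padic p)) (hpf (Datum.padic p))).BΛ.obj Y).1 s₀).1 = c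
      rw [IsUnit.unit_spec]

end TateTowerArithFrd

namespace TemperedFrobenioid

open TateTowerArithFrd LogDivisorModel.TateTowerArith

variable (p : ℕ) [hp : Fact p.Prime]

section AnyBase

variable {D : Type u} [Category.{v} D] {VD : FrdICatStub.{u, v, 0} D}
  (C₀ : TemperedFrobenioid (RealifiedDivisorMonoids.ofRlfZWeak (dm (Datum.padic p)) (hpf (Datum.padic p))) D VD)

/-- **`hP34` holds for EVERY tempered Frobenioid over the `ℚ_p`-tower data** (ANY base category `D`, base functor `D → D₀`,
category vocabulary `VD`): at every object `A`, with `L := Spec ℚ_p` (`PadicFrd.qpFld p`, abc-iut-L1-t4's `isPadicLocal_qpFld`),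
`Ker(B₀^Λ(Y_A)ˣ → (Φ₀^ℝ)^gp(Y_A)) ≃* O_L^× = ℤ_p^×` — Prop. 3.4 (ii) isomorphism 1 in the LITERAL currency of
`TemperedFrobenioid.thm37_i_node`. [cite: MochizukiEtTh2009, Prop 3.4 p.74] -/
theorem hP34_padicTower (A : Dᵒᵖ) :
    ∃ L : PadicFrd.PadicFld.{0} p, L.IsPadicLocal ∧
      Nonempty ((((RealifiedDivisorMonoids.ofRlfZWeak (dm (Datum.padic p)) (hpf (Datum.padic p))).divΛ (C₀.baseOp A)).comp
        (Units.coeHom ((RealifiedDivisorMonoids.ofRlfZWeak (dm (Datum.padic p)) (hpf (Datum.padic p))).BΛ.obj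
          (C₀.baseOp A)))).ker ≃* PadicFrd.unitSubgroup L.K) :=
  ⟨PadicFrd.qpFld p, PadicFrd.isPadicLocal_qpFld p, nonempty_ker_mulEquiv_padicUnits_obj p (C₀.baseOp A)⟩

/-- The monoid type of any tempered Frobenioid over the `ℚ_p`-tower data is `ℤ`. [cite: MochizukiEtTh2009, Def 3.6 p.77] -/
theorem monoidType_padicTower : C₀.monoidType = MonoidType.Z := rfl

end AnyBase

/-! ### §3 Over `treeCatVocab D R′ S′`: Thm. 3.7 (i), all seven clauses ⟸ {`hBmon`} alone -/

section TreeCatVocab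

variable {D : Type u} [Category.{v} D] (R' S' : (Dᵒᵖ ⥤ CommMonCat.{0}) → Prop)
  (C₀ : TemperedFrobenioid (RealifiedDivisorMonoids.ofRlfZWeak (dm (Datum.padic p)) (hpf (Datum.padic p))) D (treeCatVocab D R' S'))

/-- **[EtTh] Thm. 3.7 (i), all seven printed clauses, for EVERY tempered Frobenioid over the `ℚ_p`-tower data and the canonical
category vocabulary, modulo `hBmon` ALONE** ([FrdI] Thm. 5.2 preamble «`𝔹` a monoid on `D`»): abc-iut-w4-d103's `thm37_i_node` with
`hP34 := hP34_padicTower` and `hinj` vacuous (`Λ = ℤ`). [cite: MochizukiEtTh2009, Thm 3.7 (i) p.79] -/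
theorem thm37_i_node_padicTower (hBmon : IsMonoidOn C₀.ratFnFunctor) :
    PreFrobenioid.IsOfUnitProfiniteType C₀.toElem ∧
      (C₀.monoidType = MonoidType.R → PreFrobenioid.IsOfType (PreFrobenioid.IsUnitTrivial C₀.toElem)) ∧
      PreFrobenioid.IsOfIsotropicType C₀.toElem ∧
      PreFrobenioid.IsOfModelType C₀.toElem (C₀.isFrobenioid_treeCatVocab_of_isMonoidOn hBmon)
        (PreFrobenioid.hasBiratSquares_of_isFrobenioid (C₀.isFrobenioid_treeCatVocab_of_isMonoidOn hBmon)) ∧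
      PreFrobenioidData.IsOfBiratFrobeniusNormalizedType
        (PreFrobenioid.biratData (C₀.isFrobenioid_treeCatVocab_of_isMonoidOn hBmon)
          (PreFrobenioid.hasBiratSquares_of_isFrobenioid (C₀.isFrobenioid_treeCatVocab_of_isMonoidOn hBmon))) ∧
      PreFrobenioid.IsOfType (PreFrobenioid.IsSubQuasiFrobeniusTrivial C₀.toElem) ∧
      ¬ PreFrobenioid.IsOfType (PreFrobenioid.IsGroupLikeObj C₀.toElem) :=
  have h := C₀.thm37_i_node (p := p) hBmon (fun _ => C₀.hP34_padicTower p)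
    (fun h => absurd ((C₀.monoidType_padicTower p).symm.trans h) (by decide))
  ⟨h.1 (C₀.monoidType_padicTower p), h.2⟩

end TreeCatVocab

/-! ### §4 At print's genuine base `B^temp(Π)⁰`: Thm. 3.7 (i) and (iv) with NO binder for EVERY tempered Frobenioid -/

section GenuineBase

variable {Γ : Type} [Group Γ] [TopologicalSpace Γ] (R' S' : ((ConnectedPart (BTemp Γ))ᵒᵖ ⥤ CommMonCat.{0}) → Prop)
  (C₀ : TemperedFrobenioid (RealifiedDivisorMonoids.ofRlfZWeak (dm (Datum.padic p)) (hpf (Datum.padic p)))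
    (ConnectedPart (BTemp Γ)) (treeCatVocab (ConnectedPart (BTemp Γ)) R' S'))

/-- `hBD` (base-image injectivity of `B₀^Λ`) for every tempered Frobenioid over the `ℚ_p`-tower data — abc-iut-w6-d058's
`hBinj_tateTowerArith` (all `B₀`-transitions of the arithmetic tower are injective). [cite: MochizukiEtTh2009, Def 3.6 p.76] -/
theorem hBD_padicTower {A B : ConnectedPart (BTemp Γ)} (α : B ⟶ A) :
    Injective ((RealifiedDivisorMonoids.ofRlfZWeak (dm (Datum.padic p)) (hpf (Datum.padic p))).BΛ.map (C₀.base.map α).op).hom :=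
  hBinj_tateTowerArith (Datum.padic p) _

/-- **[EtTh] Theorem 3.7 (i) — ALL SEVEN printed clauses with NO binder, for EVERY tempered Frobenioid over the `ℚ_p` arithmetic
Tate tower data and print's genuine base `B^temp(Π)⁰`** (every topological group `Π`, every vocabulary `R′ S′`, every `Φ`):
(1) unit-profinite BY PRINT'S ROUTE (Prop. 3.4 (ii) iso 1 = `hP34_padicTower` + [FrdII] Thm. 1.2 (i)), (2) the `Λ = ℝ` clause (vacuous),
(3) isotropic, (4) model, (5) birationally Frobenius-normalized, (6) sub-quasi-Frobenius-trivial, (7) not group-like — abc-iut-w5-d179's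
`thm37_i_node_connectedPart_of_baseInj` fed with `hBD := hBD_padicTower` («`B` is a monoid on `D`» then needs nothing: FSM clause by
[FrdII] Ex. 1.3 (i), `isMonoidOn_ratFnFunctor_connectedPart_of_baseInj`), `hP34 := hP34_padicTower`, `hinj` vacuous.  The quantifier is
non-vacuous (`TateTowerArithFrd.nonempty_temperedFrobenioid_connectedPart`). [cite: MochizukiEtTh2009, Thm 3.7 (i) p.79] -/
theorem thm37_i_padicTower_connectedPart :
    PreFrobenioid.IsOfUnitProfiniteType C₀.toElem ∧
      (C₀.monoidType = MonoidType.R → PreFrobenioid.IsOfType (PreFrobenioid.IsUnitTrivial C₀.toElem)) ∧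
      PreFrobenioid.IsOfIsotropicType C₀.toElem ∧
      PreFrobenioid.IsOfModelType C₀.toElem
        (C₀.isFrobenioid_treeCatVocab_of_isMonoidOn (C₀.isMonoidOn_ratFnFunctor_connectedPart_of_baseInj fun α => C₀.hBD_padicTower p R' S' α))
        (PreFrobenioid.hasBiratSquares_of_isFrobenioid
          (C₀.isFrobenioid_treeCatVocab_of_isMonoidOn (C₀.isMonoidOn_ratFnFunctor_connectedPart_of_baseInj fun α => C₀.hBD_padicTower p R' S' α))) ∧
      PreFrobenioidData.IsOfBiratFrobeniusNormalizedType
        (PreFrobenioid.biratData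
          (C₀.isFrobenioid_treeCatVocab_of_isMonoidOn (C₀.isMonoidOn_ratFnFunctor_connectedPart_of_baseInj fun α => C₀.hBD_padicTower p R' S' α))
          (PreFrobenioid.hasBiratSquares_of_isFrobenioid
            (C₀.isFrobenioid_treeCatVocab_of_isMonoidOn (C₀.isMonoidOn_ratFnFunctor_connectedPart_of_baseInj fun α => C₀.hBD_padicTower p R' S' α)))) ∧
      PreFrobenioid.IsOfType (PreFrobenioid.IsSubQuasiFrobeniusTrivial C₀.toElem) ∧
      ¬ PreFrobenioid.IsOfType (PreFrobenioid.IsGroupLikeObj C₀.toElem) :=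
  have h := C₀.thm37_i_node_connectedPart_of_baseInj (p := p) (fun α => C₀.hBD_padicTower p R' S' α)
    (fun _ => C₀.hP34_padicTower p) (fun h => absurd ((C₀.monoidType_padicTower p).symm.trans h) (by decide))
  ⟨h.1 (C₀.monoidType_padicTower p), h.2⟩

/-- **Clause (1) alone: EVERY tempered Frobenioid over (`ℚ_p`-tower data, `B^temp(Π)⁰`) is of UNIT-PROFINITE type, outright.**
[cite: MochizukiEtTh2009, Thm 3.7 (i) p.79] -/
theorem isOfUnitProfiniteType_padicTower_connectedPart : PreFrobenioid.IsOfUnitProfiniteType C₀.toElem :=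
  (C₀.thm37_i_padicTower_connectedPart p R' S').1

/-- **[EtTh] Theorem 3.7 (iv) AS TYPED (`Thm37_iv`: "`D` slim, `Λ ∈ {ℤ, ℝ}` ⟹ `C` slim") with NO binder for EVERY tempered Frobenioid
over (`ℚ_p`-tower data, `B^temp(Π)⁰`)** — abc-iut-w4-d103's `thm37_iv_node_connectedPart_of_baseInj` fed with `hBD := hBD_padicTower`,
`hP34 := hP34_padicTower`, `hinj` vacuous — TOGETHER WITH its side-condition-free reading here (`Λ = ℤ` holds): «`B^temp(Π)⁰` slim ⟹ `C`
slim». [cite: MochizukiEtTh2009, Thm 3.7 (iv) p.80] -/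
theorem thm37_iv_padicTower_connectedPart :
    C₀.Thm37_iv ∧ (IsSlim (ConnectedPart (BTemp Γ)) → IsSlim C₀.category) :=
  have h : C₀.Thm37_iv := C₀.thm37_iv_node_connectedPart_of_baseInj (p := p) (fun α => C₀.hBD_padicTower p R' S' α)
    (fun _ => C₀.hP34_padicTower p) (fun h => absurd ((C₀.monoidType_padicTower p).symm.trans h) (by decide))
  ⟨h, fun hD => h hD (Or.inl (C₀.monoidType_padicTower p))⟩

end GenuineBase

end TemperedFrobenioid

end Literature.AnabelianGeometry.EtaleTheta

end
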